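import Summits.AtomisticToContinuum.HydrodynamicLimit.Theorems.CollisionIsometryCLTCollisionalTransferLocalityBlockFields
import Summits.AtomisticToContinuum.HydrodynamicLimit.Theorems.CollisionIsometryCLTCollisionalTransferLocalityVelocityAverages
import HarnessLib

/-!
# Block velocity fluctuations of the homogeneous gas vanish (line `hemisphere-affine-slaving`)

Support file (`--supports stmt-AtomisticToContinuum-9518`) of the lead prover of the line
`hemisphere-affine-slaving` for the crux `CollisionalTransferLocality`, landing the registered stub
`stub_blockVelocityLLNConst` ([CL-v]): under the homogeneous local Gibbs law
`G_N = localGibbsLaw σ 1 0 θ N (Φ N)` (`σ ≤ 1/2`, `θ > 0`, any flow family) and for an admissible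
kernel family `φ_N` (mesoscale `(N+1)^{-γ}`, `0 < γ ≤ 1/15`, `0 ≤ φ_N ≤ C (N+1)^{3γ}`, mass one), the
mesoscopic momentum and kinetic-energy fluctuations of the block fields vanish in `L²(𝕋³)` in
probability: `G_N {δ < ∫ₓ |m̄|² + (Ē − (3θ/2) ρ̄)²} → 0`.

## Proof (second moment + Markov, integrating over `x` first)

* Pointwise, `|m̄|² + (Ē − (3θ/2) ρ̄)² = Σ_l ((N+1)⁻¹ Σᵢ φ(xᵢ − x) v_{il})² + ((N+1)⁻¹ Σᵢ φ(xᵢ − x) eᵢ)²`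
  with the centred marks `v_l` (`l = 0, 1, 2`) and `e = |v|²/2 − 3θ/2` (`integrand_eq`).
* Integrating over the torus first, `∫ₓ ((N+1)⁻¹ Σᵢ φ(xᵢ − x) qᵢ)² dx = (N+1)⁻² Σᵢⱼ qᵢ qⱼ A(xᵢ, xⱼ)`
  with the overlap `A(y, y') = ∫ₓ φ(y − x) φ(y' − x) dx ∈ [0, ‖φ‖_∞]` (`integral_sq_wsum`,
  `overlap_le`: `∫ₓ φ(y' − x) dx = 1` by invariance of Haar measure).
* Under `G_N` positions and velocities are independent and the velocities are i.i.d. `N(0, θ id)`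
  (`integral_localGibbsLaw_rung0`, `integral_pi_pair`): the off-diagonal expectations
  `E[qᵢ qⱼ A(xᵢ, xⱼ)] = E[A] (E q)² = 0` vanish for a centred mark (`integral_pairTerm_offDiag`), the
  diagonal ones are `≤ ‖φ‖_∞ E q²` (`integral_pairTerm_diag_le`). Hence
  `E ∫ₓ (|m̄|² + (Ē − (3θ/2) ρ̄)²) ≤ (N+1)⁻¹ ‖φ_N‖_∞ K_θ ≤ C K_θ (N+1)^{3γ−1}` with the Gaussian constant
  `K_θ = Σ_l E v_l² + E e²` (`measure_blockFluct_le`, Markov), and `3γ − 1 < 0`.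

Folklore (Bienaymé–Chebyshev for block averages of i.i.d. Maxwellian velocities); the product
structure of the homogeneous local Gibbs law is Spohn 1991, Part I §2.3, already recorded on the
imported tools. No dynamics enters.
-/

namespace Summit.AtomisticToContinuum.HydrodynamicLimit.Theorems.HemisphereAffineSlaving

open scoped BigOperators Topology Classical ENNReal InnerProductSpace
open Filter Set Function MeasureTheory

noncomputable section

open Literature.MathematicalPhysics.KineticTheory (T3 V3)
open Literature.MathematicalPhysics.KineticTheory (gaussMeasure localGibbsLaw posGibbsMeasure hsDiameter
  zipConfig zipConfig_apply integral_localGibbsLaw_rung0 integral_pi_pair memLp_coord_gaussMeasure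
  memLp_energy_gaussMeasure integral_coord_gaussMeasure integral_energy_gaussMeasure
  isProbabilityMeasure_localGibbsLaw isProbabilityMeasure_posGibbsMeasure)

namespace BlockVelocityLLNConst

variable {N : ℕ}

/-! ### Pathwise algebra: the integrand as four squares of scalar weighted averages -/

/-- Coordinates of the block momentum: `m̄_l = (N+1)⁻¹ Σᵢ φ(xᵢ − x) v_{il}`. [folklore] -/
theorem mB_apply (φ : ℕ → T3 → ℝ) (w : Cfg N) (x : T3) (l : Fin 3) :
    mB φ N w x l = ((N + 1 : ℕ) : ℝ)⁻¹ * ∑ i, φ N ((w i).1 - x) * (w i).2 l := by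
  simp only [mB_eq, PiLp.smul_apply, WithLp.ofLp_sum, Finset.sum_apply, smul_eq_mul, Finset.mul_sum]

/-- The integrand `|m̄|² + (Ē − (3θ/2) ρ̄)²` is the sum of four squares of scalar weighted velocity
averages `(N+1)⁻¹ Σᵢ φ(xᵢ − x) q(vᵢ)`, with the marks `q ∈ {v₀, v₁, v₂, |v|²/2 − 3θ/2}`. [folklore] -/
theorem integrand_eq (θ : ℝ) (φ : ℕ → T3 → ℝ) (w : Cfg N) (x : T3) :
    ‖mB φ N w x‖ ^ 2 + (EB φ N w x - 3 / 2 * θ * rhoB φ N w x) ^ 2 =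
      (∑ l, (((N + 1 : ℕ) : ℝ)⁻¹ * ∑ i, φ N ((w i).1 - x) * (w i).2 l) ^ 2) +
        (((N + 1 : ℕ) : ℝ)⁻¹ * ∑ i, φ N ((w i).1 - x) * (‖(w i).2‖ ^ 2 / 2 - 3 / 2 * θ)) ^ 2 := by
  rw [EuclideanSpace.real_norm_sq_eq]
  congr 1
  · exact Finset.sum_congr rfl fun l _ => by rw [mB_apply]
  · rw [EB_eq, rhoB_eq]
    congr 1
    simp only [Finset.mul_sum, ← Finset.sum_sub_distrib]
    exact Finset.sum_congr rfl fun i _ => by ring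

/-- **Integrating over `x` first**: for positions `a`, scalar marks `b` and a continuous kernel `f`,
`∫ₓ (c Σᵢ f(aᵢ − x) bᵢ)² dx = c² Σᵢ Σⱼ bᵢ bⱼ ∫ₓ f(aᵢ − x) f(aⱼ − x) dx` (finite sums out of the
integral over the compact torus). [folklore] -/
theorem integral_sq_wsum {f : T3 → ℝ} (hf : Continuous f) (a : Fin (N + 1) → T3)
    (b : Fin (N + 1) → ℝ) (c : ℝ) :
    ∫ x, (c * ∑ i, f (a i - x) * b i) ^ 2 =
      c ^ 2 * ∑ i, ∑ j, b i * b j * ∫ x, f (a i - x) * f (a j - x) := by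
  have hpt : ∀ x, (c * ∑ i, f (a i - x) * b i) ^ 2 =
      c ^ 2 * ∑ i, ∑ j, b i * b j * (f (a i - x) * f (a j - x)) := by
    intro x
    rw [mul_pow, sq (∑ i, f (a i - x) * b i), Finset.sum_mul_sum]
    congr 1
    exact Finset.sum_congr rfl fun i _ => Finset.sum_congr rfl fun j _ => by ring
  have hint : ∀ i j, Integrable (fun x => b i * b j * (f (a i - x) * f (a j - x))) := fun i j =>
    Continuous.integrable_unitAddTorus (by fun_prop)
  simp_rw [hpt]
  rw [integral_const_mul, integral_finsetSum _ fun i _ => integrable_finsetSum _ fun j _ => hint i j]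
  congr 1
  refine Finset.sum_congr rfl fun i _ => ?_
  rw [integral_finsetSum _ fun j _ => hint i j]
  exact Finset.sum_congr rfl fun j _ => integral_const_mul _ _

/-! ### The overlap of two translates of the kernel -/

/-- The overlap `∫ₓ f(y − x) f(y' − x) dx` of two translates of a nonnegative kernel is nonnegative.
[folklore] -/
theorem overlap_nonneg {f : T3 → ℝ} (hf0 : ∀ y, 0 ≤ f y) (y y' : T3) :
    0 ≤ ∫ x, f (y - x) * f (y' - x) :=
  integral_nonneg fun _ => mul_nonneg (hf0 _) (hf0 _)

/-- The overlap of two translates of a kernel `0 ≤ f ≤ M` of mass one is at most `M`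
(`f(y − x) f(y' − x) ≤ M f(y' − x)`, and `∫ₓ f(y' − x) dx = ∫ f = 1` since Haar measure on the torus is
invariant under `x ↦ y' − x`). [folklore] -/
theorem overlap_le {f : T3 → ℝ} (hf : Continuous f) (hf0 : ∀ y, 0 ≤ f y) {M : ℝ}
    (hfM : ∀ y, f y ≤ M) (hf1 : ∫ y, f y = 1) (y y' : T3) :
    ∫ x, f (y - x) * f (y' - x) ≤ M := by
  calc ∫ x, f (y - x) * f (y' - x) ≤ ∫ x, M * f (y' - x) :=
        integral_mono (Continuous.integrable_unitAddTorus (by fun_prop))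
          (Continuous.integrable_unitAddTorus (by fun_prop))
          fun x => mul_le_mul_of_nonneg_right (hfM _) (hf0 _)
    _ = M := by
        haveI : (volume : Measure T3).IsNegInvariant :=
          Measure.IsAddHaarMeasure.isNegInvariant_of_regular _
        rw [integral_const_mul, integral_sub_left_eq_self f volume y', hf1, mul_one]

/-- The overlap `(y, y') ↦ ∫ₓ f(y − x) f(y' − x) dx` is continuous on `𝕋³ × 𝕋³` (parametric integral
of a continuous function over a compact space). [folklore] -/
theorem continuous_overlap {f : T3 → ℝ} (hf : Continuous f) :
    Continuous fun p : T3 × T3 => ∫ x, f (p.1 - x) * f (p.2 - x) := by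
  have hF : Continuous
      (Function.uncurry fun (p : T3 × T3) (x : T3) => f (p.1 - x) * f (p.2 - x)) := by
    show Continuous fun q : (T3 × T3) × T3 => f (q.1.1 - q.2) * f (q.1.2 - q.2)
    fun_prop
  simpa only [Measure.restrict_univ] using
    continuous_parametric_integral_of_continuous hF isCompact_univ

/-! ### Expectations under the homogeneous local Gibbs law -/

/-- Squares of an `L²(N(0, θ id))` mark of one velocity are integrable under the homogeneous local
Gibbs law (each velocity is `N(0, θ id)`-distributed, `measurePreserving_vel_localGibbsLaw_const`).
[folklore] -/
theorem integrable_sq_vel {σ θ : ℝ} (hθ : 0 < θ) (hσ : σ ≤ 1 / 2) (Φ : Flows σ) (N : ℕ)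
    {q : V3 → ℝ} (hq2 : MemLp q 2 (gaussMeasure (0 : V3) θ)) (k : Fin (N + 1)) :
    Integrable (fun z : Cfg N => q (z k).2 ^ 2)
      (localGibbsLaw σ (fun _ => 1) (fun _ => 0) (fun _ => θ) N (Φ N)) :=
  -- elaborated without expected type: the unifier must not guess `g ∘ f` from `fun z => q (z k).2 ^ 2`
  ((measurePreserving_vel_localGibbsLaw_const one_pos hθ hσ 0 Φ N k).integrable_comp_of_integrable
    hq2.integrable_sq :)

/-- Each pair term `q(vᵢ) q(vⱼ) A(xᵢ, xⱼ)` is integrable under the homogeneous local Gibbs law: it is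
measurable and dominated by `M (q(vᵢ)² + q(vⱼ)²)`, each velocity being `N(0, θ id)`-distributed
(`measurePreserving_vel_localGibbsLaw_const`) and `q ∈ L²`. [folklore] -/
theorem integrable_pairTerm {σ θ : ℝ} (hθ : 0 < θ) (hσ : σ ≤ 1 / 2) (Φ : Flows σ) (N : ℕ)
    {f : T3 → ℝ} (hf : Continuous f) (hf0 : ∀ y, 0 ≤ f y) {M : ℝ} (hfM : ∀ y, f y ≤ M)
    (hf1 : ∫ y, f y = 1) {q : V3 → ℝ} (hq : Continuous q)
    (hq2 : MemLp q 2 (gaussMeasure (0 : V3) θ)) (i j : Fin (N + 1)) :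
    Integrable (fun z : Cfg N => q (z i).2 * q (z j).2 * ∫ x, f ((z i).1 - x) * f ((z j).1 - x))
      (localGibbsLaw σ (fun _ => 1) (fun _ => 0) (fun _ => θ) N (Φ N)) := by
  have hqi := integrable_sq_vel hθ hσ Φ N hq2
  have hA := continuous_overlap hf
  have hmeas : Measurable
      (fun z : Cfg N => q (z i).2 * q (z j).2 * ∫ x, f ((z i).1 - x) * f ((z j).1 - x)) :=
    ((hq.measurable.comp (measurable_pi_apply i).snd).mul
      (hq.measurable.comp (measurable_pi_apply j).snd)).mul
      (hA.measurable.comp ((measurable_pi_apply i).fst.prodMk (measurable_pi_apply j).fst))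
  refine (((hqi i).add (hqi j)).const_mul M).mono' hmeas.aestronglyMeasurable
    (ae_of_all _ fun z => ?_)
  rw [Real.norm_eq_abs, abs_mul, abs_of_nonneg (overlap_nonneg hf0 _ _), abs_mul]
  have h1 : |q (z i).2| * |q (z j).2| ≤ q (z i).2 ^ 2 + q (z j).2 ^ 2 := by
    nlinarith [sq_nonneg (|q (z i).2| - |q (z j).2|), sq_abs (q (z i).2), sq_abs (q (z j).2),
      abs_nonneg (q (z i).2), abs_nonneg (q (z j).2)]
  have hM0 : 0 ≤ M := (hf0 0).trans (hfM 0)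
  calc |q (z i).2| * |q (z j).2| * ∫ x, f ((z i).1 - x) * f ((z j).1 - x)
      ≤ (q (z i).2 ^ 2 + q (z j).2 ^ 2) * M :=
        mul_le_mul h1 (overlap_le hf hf0 hfM hf1 _ _) (overlap_nonneg hf0 _ _) (by positivity)
    _ = M * (q (z i).2 ^ 2 + q (z j).2 ^ 2) := mul_comm _ _

/-- **Diagonal terms**: `E[q(vᵢ)² A(xᵢ, xᵢ)] ≤ M · E q²` (`0 ≤ A ≤ M` and `vᵢ ~ N(0, θ id)`).
[folklore] -/
theorem integral_pairTerm_diag_le {σ θ : ℝ} (hθ : 0 < θ) (hσ : σ ≤ 1 / 2) (Φ : Flows σ) (N : ℕ)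
    {f : T3 → ℝ} (hf : Continuous f) (hf0 : ∀ y, 0 ≤ f y) {M : ℝ} (hfM : ∀ y, f y ≤ M)
    (hf1 : ∫ y, f y = 1) {q : V3 → ℝ} (hq : Continuous q)
    (hq2 : MemLp q 2 (gaussMeasure (0 : V3) θ)) (i : Fin (N + 1)) :
    ∫ z, q (z i).2 * q (z i).2 * (∫ x, f ((z i).1 - x) * f ((z i).1 - x))
        ∂(localGibbsLaw σ (fun _ => 1) (fun _ => 0) (fun _ => θ) N (Φ N)) ≤
      M * ∫ v, q v ^ 2 ∂(gaussMeasure (0 : V3) θ) := by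
  have hsq : Integrable (fun v => q v ^ 2) (gaussMeasure (0 : V3) θ) := hq2.integrable_sq
  have hqi := integrable_sq_vel hθ hσ Φ N hq2 i
  calc ∫ z, q (z i).2 * q (z i).2 * (∫ x, f ((z i).1 - x) * f ((z i).1 - x))
        ∂(localGibbsLaw σ (fun _ => 1) (fun _ => 0) (fun _ => θ) N (Φ N))
      ≤ ∫ z, M * q (z i).2 ^ 2 ∂(localGibbsLaw σ (fun _ => 1) (fun _ => 0) (fun _ => θ) N (Φ N)) :=
        integral_mono (integrable_pairTerm hθ hσ Φ N hf hf0 hfM hf1 hq hq2 i i) (hqi.const_mul M)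
          fun z => by
            have hA := overlap_le hf hf0 hfM hf1 (z i).1 (z i).1
            have hq0 : 0 ≤ q (z i).2 * q (z i).2 := mul_self_nonneg _
            calc q (z i).2 * q (z i).2 * ∫ x, f ((z i).1 - x) * f ((z i).1 - x)
                ≤ q (z i).2 * q (z i).2 * M := mul_le_mul_of_nonneg_left hA hq0
              _ = M * q (z i).2 ^ 2 := by ring
    _ = M * ∫ v, q v ^ 2 ∂(gaussMeasure (0 : V3) θ) := by
        rw [integral_const_mul, integral_vel_localGibbsLaw_const one_pos hθ hσ 0 Φ N i hsq]

/-- **Off-diagonal terms vanish**: for `i ≠ j` and a centred mark `q` (`E q = 0` under `N(0, θ id)`),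
`E[q(vᵢ) q(vⱼ) A(xᵢ, xⱼ)] = E[A(xᵢ, xⱼ)] · (E q)² = 0` — positions and velocities are independent
under the homogeneous local Gibbs law and the velocities are i.i.d. (`integral_localGibbsLaw_rung0`,
`integral_prod_mul`, `integral_pi_pair`). [folklore] -/
theorem integral_pairTerm_offDiag {σ θ : ℝ} (hθ : 0 < θ) (hσ : σ ≤ 1 / 2) (Φ : Flows σ) (N : ℕ)
    (f : T3 → ℝ) {q : V3 → ℝ} (hq : Continuous q)
    (hq0 : ∫ v, q v ∂(gaussMeasure (0 : V3) θ) = 0) {i j : Fin (N + 1)} (hij : i ≠ j) :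
    ∫ z, q (z i).2 * q (z j).2 * (∫ x, f ((z i).1 - x) * f ((z j).1 - x))
        ∂(localGibbsLaw σ (fun _ => 1) (fun _ => 0) (fun _ => θ) N (Φ N)) = 0 := by
  haveI := isProbabilityMeasure_posGibbsMeasure (a₀ := fun _ : T3 => (1 : ℝ)) continuous_const
    (fun _ => one_pos) hσ N
  have hvel : ∫ vs, q (vs i) * q (vs j) ∂(Measure.pi fun _ : Fin (N + 1) => gaussMeasure (0 : V3) θ) =
      0 := by
    have h1 : ∫ vs, q (vs i) * q (vs j) ∂(Measure.pi fun _ : Fin (N + 1) => gaussMeasure (0 : V3) θ) =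
        ∫ pr, q pr.1 * q pr.2 ∂((gaussMeasure (0 : V3) θ).prod (gaussMeasure (0 : V3) θ)) :=
      integral_pi_pair (gaussMeasure (0 : V3) θ) hij (f := fun pr : V3 × V3 => q pr.1 * q pr.2)
        ((hq.comp continuous_fst).mul (hq.comp continuous_snd)).aestronglyMeasurable
    rw [h1, integral_prod_mul q q, hq0, mul_zero]
  rw [integral_localGibbsLaw_rung0 σ zero_le_one hθ (0 : V3) N (Φ N)
    (fun z : Cfg N => q (z i).2 * q (z j).2 * ∫ x, f ((z i).1 - x) * f ((z j).1 - x))]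
  have hfun : (fun p : (Fin (N + 1) → T3) × (Fin (N + 1) → V3) =>
      q (zipConfig p i).2 * q (zipConfig p j).2 *
        ∫ x, f ((zipConfig p i).1 - x) * f ((zipConfig p j).1 - x)) =
      fun p => (fun xs : Fin (N + 1) → T3 => ∫ x, f (xs i - x) * f (xs j - x)) p.1 *
        (fun vs : Fin (N + 1) → V3 => q (vs i) * q (vs j)) p.2 := by
    funext p
    simp only [zipConfig_apply]
    ring
  rw [hfun, integral_prod_mul (f := fun xs : Fin (N + 1) → T3 => ∫ x, f (xs i - x) * f (xs j - x))
    (g := fun vs : Fin (N + 1) → V3 => q (vs i) * q (vs j)), hvel, mul_zero]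

/-- **The double sum**: for a centred mark `q ∈ L²(N(0, θ id))` and a kernel `0 ≤ f ≤ M` of mass one,
`z ↦ Σᵢ Σⱼ q(vᵢ) q(vⱼ) A(xᵢ, xⱼ)` is integrable under the homogeneous local Gibbs law with
expectation `≤ (N+1) M E q²` (only the `N + 1` diagonal terms survive). [folklore] -/
theorem integral_doubleSum_le {σ θ : ℝ} (hθ : 0 < θ) (hσ : σ ≤ 1 / 2) (Φ : Flows σ) (N : ℕ)
    {f : T3 → ℝ} (hf : Continuous f) (hf0 : ∀ y, 0 ≤ f y) {M : ℝ} (hfM : ∀ y, f y ≤ M)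
    (hf1 : ∫ y, f y = 1) {q : V3 → ℝ} (hq : Continuous q)
    (hq2 : MemLp q 2 (gaussMeasure (0 : V3) θ)) (hq0 : ∫ v, q v ∂(gaussMeasure (0 : V3) θ) = 0) :
    Integrable (fun z : Cfg N =>
        ∑ i, ∑ j, q (z i).2 * q (z j).2 * ∫ x, f ((z i).1 - x) * f ((z j).1 - x))
        (localGibbsLaw σ (fun _ => 1) (fun _ => 0) (fun _ => θ) N (Φ N)) ∧
      ∫ z, ∑ i, ∑ j, q (z i).2 * q (z j).2 * (∫ x, f ((z i).1 - x) * f ((z j).1 - x))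
          ∂(localGibbsLaw σ (fun _ => 1) (fun _ => 0) (fun _ => θ) N (Φ N)) ≤
        ((N : ℝ) + 1) * (M * ∫ v, q v ^ 2 ∂(gaussMeasure (0 : V3) θ)) := by
  have hT := integrable_pairTerm hθ hσ Φ N hf hf0 hfM hf1 hq hq2
  refine ⟨integrable_finsetSum _ fun i _ => integrable_finsetSum _ fun j _ => hT i j, ?_⟩
  rw [integral_finsetSum _ fun i _ => integrable_finsetSum _ fun j _ => hT i j]
  calc ∑ i, ∫ z, ∑ j, q (z i).2 * q (z j).2 * (∫ x, f ((z i).1 - x) * f ((z j).1 - x))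
          ∂(localGibbsLaw σ (fun _ => 1) (fun _ => 0) (fun _ => θ) N (Φ N))
      = ∑ i, ∫ z, q (z i).2 * q (z i).2 * (∫ x, f ((z i).1 - x) * f ((z i).1 - x))
          ∂(localGibbsLaw σ (fun _ => 1) (fun _ => 0) (fun _ => θ) N (Φ N)) := by
        refine Finset.sum_congr rfl fun i _ => ?_
        rw [integral_finsetSum _ fun j _ => hT i j]
        exact Finset.sum_eq_single i
          (fun j _ hji => integral_pairTerm_offDiag hθ hσ Φ N f hq hq0 (Ne.symm hji))
          (fun h => absurd (Finset.mem_univ i) h)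
    _ ≤ ∑ _i : Fin (N + 1), M * ∫ v, q v ^ 2 ∂(gaussMeasure (0 : V3) θ) :=
        Finset.sum_le_sum fun i _ => integral_pairTerm_diag_le hθ hσ Φ N hf hf0 hfM hf1 hq hq2 i
    _ = ((N : ℝ) + 1) * (M * ∫ v, q v ^ 2 ∂(gaussMeasure (0 : V3) θ)) := by
        rw [Finset.sum_const, Finset.card_univ, Fintype.card_fin, nsmul_eq_mul, Nat.cast_add,
          Nat.cast_one]

/-! ### Second moment and Markov at fixed `N` -/

/-- **Markov bound at fixed `N`.** Under the homogeneous local Gibbs law (`σ ≤ 1/2`, `θ > 0`) and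
for a continuous kernel `0 ≤ φ_N ≤ M` of mass one,
`G_N {δ < ∫ₓ |m̄|² + (Ē − (3θ/2) ρ̄)²} ≤ ((N+1)⁻¹ M K_θ) / δ` with the Gaussian constant
`K_θ = Σ_l E v_l² + E (|v|²/2 − 3θ/2)²` of `N(0, θ id)`: integrate over `x` first
(`integral_sq_wsum`), take expectations (`integral_doubleSum_le` for the four centred marks
`v₀, v₁, v₂, |v|²/2 − 3θ/2`), and apply Markov's inequality. [folklore] -/
theorem measure_blockFluct_le {σ θ : ℝ} (hθ : 0 < θ) (hσ : σ ≤ 1 / 2) (Φ : Flows σ) (N : ℕ)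
    {φ : ℕ → T3 → ℝ} (hφc : Continuous (φ N)) (hφ0 : ∀ y, 0 ≤ φ N y) {M : ℝ}
    (hφM : ∀ y, φ N y ≤ M) (hφ1 : ∫ y, φ N y = 1) {δ : ℝ} (hδ : 0 < δ) :
    localGibbsLaw σ (fun _ => 1) (fun _ => 0) (fun _ => θ) N (Φ N)
        {z | δ < ∫ x, (‖mB φ N z x‖ ^ 2 + (EB φ N z x - 3 / 2 * θ * rhoB φ N z x) ^ 2)} ≤
      ENNReal.ofReal (((N : ℝ) + 1)⁻¹ * M *
        ((∑ l : Fin 3, ∫ v, v l ^ 2 ∂(gaussMeasure (0 : V3) θ)) +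
          ∫ v, (‖v‖ ^ 2 / 2 - 3 / 2 * θ) ^ 2 ∂(gaussMeasure (0 : V3) θ)) / δ) := by
  set P := localGibbsLaw σ (fun _ => (1 : ℝ)) (fun _ => (0 : V3)) (fun _ => θ) N (Φ N)
  haveI : IsProbabilityMeasure P := isProbabilityMeasure_localGibbsLaw continuous_const
    continuous_const continuous_const (fun _ => one_pos) (fun _ => hθ) hσ N (Φ N)
  have hn : ((N + 1 : ℕ) : ℝ) = (N : ℝ) + 1 := by push_cast; ring
  -- the four centred marks `v₀, v₁, v₂, |v|²/2 − 3θ/2`: continuity, square integrability, mean zero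
  have hcc : ∀ l : Fin 3, Continuous fun v : V3 => v l := fun l =>
    (EuclideanSpace.proj (𝕜 := ℝ) l).continuous
  have hc2 : ∀ l : Fin 3, MemLp (fun v : V3 => v l) 2 (gaussMeasure (0 : V3) θ) := fun l =>
    memLp_coord_gaussMeasure (0 : V3) θ l 2 (by simp)
  have hc0 : ∀ l : Fin 3, ∫ v, v l ∂(gaussMeasure (0 : V3) θ) = 0 := fun l => by
    rw [integral_coord_gaussMeasure (0 : V3) hθ l]; rfl
  have hec : Continuous fun v : V3 => ‖v‖ ^ 2 / 2 - 3 / 2 * θ := by fun_prop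
  have he2 : MemLp (fun v : V3 => ‖v‖ ^ 2 / 2 - 3 / 2 * θ) 2 (gaussMeasure (0 : V3) θ) :=
    memLp_energy_gaussMeasure (0 : V3) θ (3 / 2 * θ)
  have he0 : ∫ v, (‖v‖ ^ 2 / 2 - 3 / 2 * θ) ∂(gaussMeasure (0 : V3) θ) = 0 := by
    have h := integral_energy_gaussMeasure (0 : V3) hθ
    have hfun : (fun v : V3 => ‖v‖ ^ 2 / 2 - ‖(0 : V3)‖ ^ 2 / 2 - (Fintype.card (Fin 3) : ℝ) * θ / 2) =
        fun v : V3 => ‖v‖ ^ 2 / 2 - 3 / 2 * θ := by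
      funext v; rw [norm_zero, Fintype.card_fin]; push_cast; ring
    rwa [hfun] at h
  -- expectations of the four double sums
  have hS := fun (q : V3 → ℝ) (hq : Continuous q) (hq2 : MemLp q 2 (gaussMeasure (0 : V3) θ))
    (hq0 : ∫ v, q v ∂(gaussMeasure (0 : V3) θ) = 0) =>
    integral_doubleSum_le hθ hσ Φ N hφc hφ0 hφM hφ1 hq hq2 hq0
  -- the fluctuation functional with `x` integrated out (`integral_sq_wsum`)
  set D : Cfg N → ℝ := fun z =>
    (∑ l : Fin 3, ((N + 1 : ℕ) : ℝ)⁻¹ ^ 2 * ∑ i, ∑ j, (z i).2 l * (z j).2 l *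
        ∫ x, φ N ((z i).1 - x) * φ N ((z j).1 - x)) +
      ((N + 1 : ℕ) : ℝ)⁻¹ ^ 2 * ∑ i, ∑ j,
        (‖(z i).2‖ ^ 2 / 2 - 3 / 2 * θ) * (‖(z j).2‖ ^ 2 / 2 - 3 / 2 * θ) *
          ∫ x, φ N ((z i).1 - x) * φ N ((z j).1 - x) with hD
  have hFD : ∀ z : Cfg N,
      ∫ x, (‖mB φ N z x‖ ^ 2 + (EB φ N z x - 3 / 2 * θ * rhoB φ N z x) ^ 2) = D z := by
    intro z
    simp only [hD]
    simp_rw [integrand_eq θ φ z]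
    have hIl : ∀ l : Fin 3, Integrable (fun x : T3 =>
        (((N + 1 : ℕ) : ℝ)⁻¹ * ∑ i, φ N ((z i).1 - x) * (z i).2 l) ^ 2) := fun l =>
      Continuous.integrable_unitAddTorus (by fun_prop)
    rw [integral_add (integrable_finsetSum _ fun l _ => hIl l)
      (Continuous.integrable_unitAddTorus (by fun_prop)), integral_finsetSum _ fun l _ => hIl l]
    exact congrArg₂ (· + ·) (Finset.sum_congr rfl fun l _ =>
      integral_sq_wsum hφc (fun i => (z i).1) (fun i => (z i).2 l) _)
      (integral_sq_wsum hφc (fun i => (z i).1) (fun i => ‖(z i).2‖ ^ 2 / 2 - 3 / 2 * θ) _)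
  -- its expectation: only the diagonal terms survive
  have hDi : Integrable D P :=
    (integrable_finsetSum _ fun l _ => (hS _ (hcc l) (hc2 l) (hc0 l)).1.const_mul _).add
      ((hS _ hec he2 he0).1.const_mul _)
  have hDle : ∫ z, D z ∂P ≤ ((N : ℝ) + 1)⁻¹ * M *
      ((∑ l : Fin 3, ∫ v, v l ^ 2 ∂(gaussMeasure (0 : V3) θ)) +
        ∫ v, (‖v‖ ^ 2 / 2 - 3 / 2 * θ) ^ 2 ∂(gaussMeasure (0 : V3) θ)) := by
    simp only [hD]
    rw [integral_add (integrable_finsetSum _ fun l _ => (hS _ (hcc l) (hc2 l) (hc0 l)).1.const_mul _)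
      ((hS _ hec he2 he0).1.const_mul _),
      integral_finsetSum _ fun l _ => (hS _ (hcc l) (hc2 l) (hc0 l)).1.const_mul _]
    simp only [integral_const_mul, hn]
    have hc : (0 : ℝ) ≤ ((N : ℝ) + 1)⁻¹ ^ 2 := sq_nonneg _
    have hkey : ∀ t : ℝ, ((N : ℝ) + 1)⁻¹ ^ 2 * (((N : ℝ) + 1) * t) = ((N : ℝ) + 1)⁻¹ * t :=
      fun t => by rw [sq, mul_assoc, ← mul_assoc ((N : ℝ) + 1)⁻¹ ((N : ℝ) + 1) t,
        inv_mul_cancel₀ (by positivity), one_mul]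
    refine (add_le_add (Finset.sum_le_sum fun l _ =>
      mul_le_mul_of_nonneg_left (hS _ (hcc l) (hc2 l) (hc0 l)).2 hc)
      (mul_le_mul_of_nonneg_left (hS _ hec he2 he0).2 hc)).trans (le_of_eq ?_)
    simp only [← Finset.mul_sum]
    rw [hkey, hkey]
    ring
  have hD0 : ∀ z, 0 ≤ D z := fun z => (hFD z) ▸ integral_nonneg fun x => by positivity
  -- Markov's inequality
  have hM := mul_meas_ge_le_integral_of_nonneg (ae_of_all _ hD0) hDi δ
  calc P {z | δ < ∫ x, (‖mB φ N z x‖ ^ 2 + (EB φ N z x - 3 / 2 * θ * rhoB φ N z x) ^ 2)}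
      ≤ P {z | δ ≤ D z} := measure_mono fun z hz => by
        simp only [mem_setOf_eq] at hz ⊢
        rw [hFD z] at hz
        exact hz.le
    _ ≤ ENNReal.ofReal ((∫ z, D z ∂P) / δ) := by
        rw [← ENNReal.ofReal_toReal (measure_ne_top P {z | δ ≤ D z})]
        exact ENNReal.ofReal_le_ofReal (by rw [le_div_iff₀ hδ, mul_comm]; exact hM)
    _ ≤ _ := ENNReal.ofReal_le_ofReal (div_le_div_of_nonneg_right hDle hδ.le)

/-- The Chebyshev rate: `c (n + 1)^{3γ − 1} → 0` in `ℝ≥0∞` for `γ ≤ 1/15`. [folklore] -/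
theorem tendsto_ofReal_mul_rpow {γ : ℝ} (hγ : γ ≤ 1 / 15) (c : ℝ) :
    Tendsto (fun N : ℕ => ENNReal.ofReal (c * ((N : ℝ) + 1) ^ (3 * γ - 1))) atTop (𝓝 0) := by
  have h1 : Tendsto (fun N : ℕ => ((N : ℝ) + 1) ^ (3 * γ - 1)) atTop (𝓝 0) := by
    have h := (tendsto_rpow_neg_atTop (by linarith : 0 < 1 - 3 * γ)).comp
      (tendsto_natCast_atTop_atTop.comp (tendsto_add_atTop_nat 1))
    refine h.congr fun N => ?_
    simp only [Function.comp_apply, Nat.cast_add, Nat.cast_one, neg_sub]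
  have h2 := ENNReal.tendsto_ofReal (h1.const_mul c)
  rwa [mul_zero, ENNReal.ofReal_zero] at h2

end BlockVelocityLLNConst

open BlockVelocityLLNConst in
/-- **Registered stub `stub_blockVelocityLLNConst` ([CL-v], line `hemisphere-affine-slaving`, crux
stmt-AtomisticToContinuum-9518): the mesoscopic momentum and kinetic-energy fluctuations of the
homogeneous hard-sphere gas vanish.** For `0 < σ ≤ 1/2`, `θ > 0`, every flow family `Φ`, every
admissible kernel family `φ` at mesoscale `(N+1)^{-γ}` (`0 < γ ≤ 1/15`) and every `δ > 0`,
`G_N {δ < ∫ₓ |m̄|² + (Ē − (3θ/2) ρ̄)²} → 0` for the homogeneous local Gibbs laws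
`G_N = localGibbsLaw σ 1 0 θ N (Φ N)`. Second moment + Markov: integrating over `x` first, the
centred Gaussian velocity marks `v_l`, `|v|²/2 − 3θ/2` are orthogonal across particles
(positions ⊗ i.i.d. `N(0, θ id)` velocities), so only the `N + 1` diagonal terms survive and
`E ∫ₓ (…) ≤ C K_θ (N+1)^{3γ−1} → 0` (`measure_blockFluct_le`, `3γ − 1 < 0`). [folklore] -/
theorem stub_blockVelocityLLNConst : ∀ σ : ℝ, 0 < σ → σ ≤ 1 / 2 → ∀ θ : ℝ, 0 < θ → ∀ (Φ : Flows σ) (γ C : ℝ) (φ : ℕ → T3 → ℝ), 0 < γ → γ ≤ 1 / 15 → AdmissibleKernel γ C φ → ∀ δ : ℝ, 0 < δ → Tendsto (fun N : ℕ => Literature.MathematicalPhysics.KineticTheory.localGibbsLaw σ (fun _ => 1) (fun _ => 0) (fun _ => θ) N (Φ N) {z | δ < ∫ x, (‖mB φ N z x‖ ^ 2 + (EB φ N z x - 3 / 2 * θ * rhoB φ N z x) ^ 2)}) atTop (𝓝 0) := by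
  intro σ _hσ0 hσ θ hθ Φ γ C φ _hγ hγ hK δ hδ
  have hφc : ∀ N, Continuous (φ N) := fun N => (hK.1 N).continuous
  have hφ0 : ∀ N y, 0 ≤ φ N y := hK.2.1
  have hφ1 : ∀ N, ∫ y, φ N y = 1 := hK.2.2.1
  have hφM : ∀ (N : ℕ) y, φ N y ≤ C * ((N : ℝ) + 1) ^ (3 * γ) := hK.2.2.2.2.1
  -- the Gaussian constant `K_θ = Σ_l E v_l² + E (|v|²/2 − 3θ/2)²`
  set Kθ : ℝ := (∑ l : Fin 3, ∫ v, v l ^ 2 ∂(gaussMeasure (0 : V3) θ)) +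
    ∫ v, (‖v‖ ^ 2 / 2 - 3 / 2 * θ) ^ 2 ∂(gaussMeasure (0 : V3) θ) with hKθ
  refine tendsto_of_tendsto_of_tendsto_of_le_of_le tendsto_const_nhds
    (tendsto_ofReal_mul_rpow hγ (C * Kθ / δ)) (fun _ => zero_le) fun N => ?_
  refine (measure_blockFluct_le hθ hσ Φ N (hφc N) (hφ0 N) (hφM N) (hφ1 N) hδ).trans
    (le_of_eq ?_)
  rw [← hKθ, Real.rpow_sub_one (by positivity) (3 * γ)]
  congr 1
  field_simp

end

end Summit.AtomisticToContinuum.HydrodynamicLimit.Theorems.HemisphereAffineSlaving
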